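import Mathlib.RingTheory.TensorProduct.Basic
import Mathlib.LinearAlgebra.TensorProduct.Tower
import Mathlib.LinearAlgebra.Dual.BaseChange
import Mathlib.Algebra.Module.Rat
import Mathlib.Algebra.Module.Equiv.Basic
import Mathlib.Algebra.Field.Subfield.Basic
import Literature.AlgebraicGeometry.Motives.BaseChange
import Literature.AlgebraicGeometry.Motives.DeRhamRealization
import Literature.AlgebraicGeometry.Motives.Varieties
import Literature.AlgebraicGeometry.Motives.PreWeilCohomology
import Literature.AlgebraicGeometry.Motives.WeilCohomology
import Literature.AlgebraicGeometry.Motives.HodgeStructure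
import Literature.AlgebraicGeometry.Motives.BettiRealization
import Literature.AlgebraicGeometry.Motives.Comparison
import HarnessLib

-- provenance: harness21/H21/H21/Prelude/MotiveL/PeriodComparison.lean @ 50fe52b (interim HEAD d8f2665); M5 mechanical rewrite
/-!
# The de Rham–Betti comparison, periods and absolute Hodge classes (trunk MotiveL, prelude C9)

For a field `k` of characteristic zero, a smooth projective `k`-variety `X` and an embedding
`σ : k →+* ℂ`, Grothendieck's comparison theorem (Grothendieck, *On the de Rham cohomology of
algebraic varieties*, Publ. IHÉS 29 (1966), Thm. 1') gives canonical isomorphisms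
`Hⁱ_dR(X/k) ⊗_{k,σ} ℂ ≅ Hⁱ((σX)(ℂ), ℚ) ⊗_ℚ ℂ`, functorial, multiplicative, carrying the Hodge
filtration of `Hⁱ_dR` to the Hodge filtration of the Hodge structure on `Hⁱ((σX)(ℂ), ℚ)`, and
carrying the de Rham class of a codimension-`p` cycle `Z` to `(2πi)ᵖ` times the Betti class of
`σZ` (Deligne, *Hodge cycles on abelian varieties*, in LNM 900 (1982), §1; Deligne–Milne,
*Tannakian categories*, I §1). The matrix coefficients of these isomorphisms are the **periods**
of `X`; a de Rham class whose image under every `σ` is `(2πi)ᵖ` times a rational Hodge class is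
an **absolute Hodge class** (Deligne 1982, §2, Def. 2.10; Charles–Schnell, *Notes on absolute
Hodge classes* (2011), Def. 11).

Following the two-speed design of the trunk, this file records the comparison as a **hypothesis
structure** `Literature.PeriodRealization k`: an algebraic de Rham realization `dR` (prelude C8), a
Betti–Hodge realization datum `B` over `ℂ` (G17 prelude C13) and, for every `σ : k →+* ℂ`,
*twisted* comparison data between `dR` and the pulled-back theory `B.comap σ : X ↦ H•_B(X_σ)`
over `L = AlongHom ℂ σ` (`ℂ` as a `k`-algebra via `σ`). The fields are named and shaped exactly
like those of the accepted G17 `Literature.AlgebraicGeometry.Motives.WeilComparison` (`iso`, `isoInv`, `isoInv_iso`, `iso_isoInv`,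
`iso_pullback`, `iso_one`, `iso_cup`, `iso_trace`, `iso_cycleClass`), so that G17's period
vocabulary `Literature.periodSet/periodField/periodMatrix` applies verbatim to `P.iso σ X i`; the only
differences are the Tate twists `(2πi)ᵖ` in `iso_cycleClass` and `(2πi)ⁿ` in `iso_trace`
(Deligne–Milne 1982, I §1; see the design note on twists) and the extra field `iso_fil`
(compatibility with the Hodge filtrations).

## Main definitions

* `Literature.AlongHom.ratLinearEquiv σ : AlongHom L σ ≃ₗ[ℚ] L`, `Literature.alongHomTensorEquiv σ V :
  AlongHom ℂ σ ⊗[ℚ] V ≃ₗ[ℚ] ℂ ⊗[ℚ] V` (glue: forgetting the `k`-algebra structure).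
* `Literature.BettiHodgeData.comap B σ : PreWeilCohomology k ℚ`, `X ↦ H•_B(X_σ)`.
* `Literature.PeriodRealization k` : the hypothesis structure; `P.isoEquiv σ hX i`, `P.bijective_iso`.
* `P.periodSetOf σ X i`, `P.periodFieldOf σ X`, `P.periodMatrixOf σ X i b₁ b₂` : periods of `X`
  along `σ` as complex numbers (via G17 `periodSet`, `periodMatrix`).
* `P.IsHodgeRelativeTo σ hXσ p α`, `P.IsAbsoluteHodge n X p α`, `P.absoluteHodgeClasses n X p` :
  Hodge classes relative to `σ` and absolute Hodge classes (Deligne 1982, Def. 2.10).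
* `P.cycleClass_isAbsoluteHodge` : cycle classes are absolute Hodge (Deligne 1982, Ex. 2.1(a)).

## Design notes

* Mathlib: searched `period`, `absoluteHodge`, `deRham`, `Comparison`, `toRatLinearEquiv`
  (nothing relevant; `AddMonoidHom.toRatLinearMap` exists but not the equivalence version). We
  use Mathlib's `Module.Dual.baseChange`, `LinearMap.baseChange`, `Submodule.baseChange`,
  `Submodule.restrictScalars/map`, `TensorProduct.congr`, `AddEquiv.toLinearEquiv`,
  `map_rat_smul`, `Subfield.closure/map`, `Matrix.map`.
* As in `WeilComparison`, the data `iso`/`isoInv` is given for all `k`-schemes and all `σ`, the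
  axioms only for smooth projective `X`; the Hodge structure on `Hⁱ_B(X_σ)` is
  `B.hodge hXσ i` for a proof `hXσ : IsSmoothProjective n X_σ`, quantified over (such proofs
  exist by the named fact `IsSmoothProjective.baseChangeHom`; `IsSmoothProjective` is a `Prop`,
  so the choice of proof is irrelevant).
* `iso_fil` is stated after restricting scalars to `ℚ` and transporting along
  `alongHomTensorEquiv` (the Hodge filtration of `B.hodge` lives on `ℂ ⊗[ℚ] V`, the comparison
  on `AlongHom ℂ σ ⊗[ℚ] V`; the two types are equal but not syntactically).
* Twists. Both `dR` and `B.W` are `WeilCohomology` data, so both traces are normalised by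
  `tr (cl (closed point z)) = deg z` (`WeilCohomology.trace_cycleClass`); with
  `iso (cl_dR Z) = (2πi)ᵖ cl_B Z_σ` (Deligne 1982, §1: the de Rham cycle class is the Betti one
  divided by `(2πi)ᵖ` under `H_B ⊗ ℂ = H_dR ⊗ ℂ`, i.e. `tr_dR = (2πi)⁻ⁿ ∫`) the only consistent
  trace twist is `tr_B (iso x) = (2πi)ⁿ · tr_dR x`. This corrects the sign `(2πi)⁻ⁿ` written in
  the outline §1(b) (an outline erratum: with `(2πi)⁻ⁿ` the structure would be uninhabited over
  any `k ↪ ℂ`, since `iso_trace ∘ iso_cycleClass` on a `k`-point of `ℙ¹` would force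
  `(2πi)² ∈ ℚ`); the consistency is recorded as the theorem `trace_comap_cycleClass`.
* Absolute Hodge classes form an additive subgroup of `H²ᵖ_dR(X)` (mathematically a `ℚ`-subspace,
  but `dR.obj X _` carries no `Module ℚ` instance here), not a `k`-subspace: scaling `α` by
  `c ∈ k` scales its image by `σ(c) ∉ ℚ`.
* Universe `0` throughout (`BettiHodgeData ℂ` and `baseChangeHom σ` force `k : Type`).
* `IsAbsoluteHodge n X p α` quantifies over proofs `hXσ : IsSmoothProjective n X_σ`; it is only
  meaningful for `X` smooth projective of dimension `n` (consumers pass `hX`).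
* `IsAbsoluteHodge.cup` takes `hX` and an explicit hypothesis `hcup` (rational Hodge classes on
  `X_σ` are stable under cup product): G17's `BettiHodgeData` does not record that `W.cup` is a
  morphism of Hodge structures, so this cannot be derived from the fields (G17 debt). With these
  hypotheses the lemma is proved; `twoPiI_mem_periodFieldOf` is proved from `iso_trace` on
  `H²(ℙ¹)`. The file has no `sorry`.

## References

* A. Grothendieck, *On the de Rham cohomology of algebraic varieties*, Publ. IHÉS 29 (1966).
* P. Deligne, *Hodge cycles on abelian varieties*, in LNM 900 (1982), §§1–2.
* P. Deligne, J. Milne, *Tannakian categories*, in LNM 900 (1982), I §1.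
* F. Charles, C. Schnell, *Notes on absolute Hodge classes* (2011), §2, Def. 11.
* A. Huber, S. Müller-Stach, *Periods and Nori motives*, Springer (2017), Ch. 11, §13.1.
-/

open CategoryTheory AlgebraicGeometry Opposite
open scoped TensorProduct

noncomputable section

namespace Literature.AlgebraicGeometry.Motives

/-! ### Glue: forgetting the `k`-algebra structure of `AlongHom` -/

namespace AlongHom

variable {k L : Type*} [CommRing k] [Field L] [CharZero L] (σ : k →+* L)

/-- The identity `AlongHom L σ ≃ₗ[ℚ] L` as a `ℚ`-linear equivalence (an additive equivalence of
`ℚ`-vector spaces is `ℚ`-linear, Mathlib `map_rat_smul`; Deligne 1982, §1). [cite: Deligne1982, §1] -/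
def ratLinearEquiv : AlongHom L σ ≃ₗ[ℚ] L :=
  (equiv σ).toAddEquiv.toLinearEquiv (map_rat_smul (equiv σ).toAddEquiv.toAddMonoidHom)

/-- `ratLinearEquiv` is `equiv` as a function. [folklore] -/
@[simp]
theorem ratLinearEquiv_apply (x : AlongHom L σ) : ratLinearEquiv σ x = equiv σ x := rfl

end AlongHom

/-- The identification `AlongHom ℂ σ ⊗[ℚ] V ≃ₗ[ℚ] ℂ ⊗[ℚ] V` (forgetting that the left factor is a
`k`-algebra via `σ`); used to compare the transported Hodge filtration of `H_dR` with the Hodge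
filtration on `ℂ ⊗_ℚ H_B` (Deligne 1982, §1). [cite: Deligne1982, §1] -/
def alongHomTensorEquiv {k : Type*} [CommRing k] (σ : k →+* ℂ) (V : Type*) [AddCommGroup V]
    [Module ℚ V] : AlongHom ℂ σ ⊗[ℚ] V ≃ₗ[ℚ] ℂ ⊗[ℚ] V :=
  TensorProduct.congr (AlongHom.ratLinearEquiv σ) (LinearEquiv.refl ℚ V)

/-- `alongHomTensorEquiv` on pure tensors. [folklore] -/
@[simp]
theorem alongHomTensorEquiv_tmul {k : Type*} [CommRing k] (σ : k →+* ℂ) {V : Type*}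
    [AddCommGroup V] [Module ℚ V] (a : AlongHom ℂ σ) (v : V) :
    alongHomTensorEquiv σ V (a ⊗ₜ v) = AlongHom.equiv σ a ⊗ₜ v := rfl

/-! ### Betti cohomology along an embedding -/

namespace BettiHodgeData

variable {k : Type} [Field k]

/-- Betti cohomology along `σ : k →+* ℂ` as a pre-Weil cohomology theory on `k`-schemes:
`X ↦ H•_B(X_σ) = H•((σX)(ℂ), ℚ)`, i.e. `B.W.comap σ` (Deligne 1982, §1, `H_σ(X)`). [cite: Deligne1982, §1   H_σ(X] -/
abbrev comap (B : BettiHodgeData ℂ) (σ : k →+* ℂ) : PreWeilCohomology k ℚ :=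
  B.W.toPreWeilCohomology.comap σ

end BettiHodgeData

/-! ### The hypothesis structure -/

/-- A **period realization** over a field `k` of characteristic zero: an algebraic de Rham
realization `dR`, Betti–Hodge realization data `B` for `ℂ`-schemes and, for every embedding
`σ : k →+* ℂ`, `L`-linear comparison maps (`L = ℂ` as a `k`-algebra via `σ`)
`iso σ X i : Hⁱ_dR(X) ⊗_{k,σ} ℂ → Hⁱ_B(X_σ) ⊗_ℚ ℂ` and `isoInv σ X i` which, for `X` smooth
projective, are mutually inverse, natural, multiplicative, unital, compatible with traces up to
`(2πi)ⁿ`, with cycle classes up to `(2πi)ᵖ`, and with the Hodge filtrations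
(Grothendieck 1966, Thm. 1'; Deligne 1982, §1; Deligne–Milne 1982, I §1). Field names mirror
`Literature.AlgebraicGeometry.Motives.WeilComparison`. [cite: Grothendieck1966, Thm. 1'] -/
structure PeriodRealization (k : Type) [Field k] [CharZero k] where
  /-- The algebraic de Rham realization `X ↦ H•_dR(X/k)` with its Hodge filtration. -/
  dR : DeRhamRealization k
  /-- The Betti–Hodge realization data `Y ↦ H•(Y(ℂ), ℚ)` on `ℂ`-schemes. -/
  B : BettiHodgeData ℂ
  /-- The comparison map `Hⁱ_dR(X) ⊗_{k,σ} ℂ →ₗ Hⁱ_B(X_σ) ⊗_ℚ ℂ` (Grothendieck 1966). -/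
  iso (σ : k →+* ℂ) (X : SchemeOver k) (i : ℕ) :
    AlongHom ℂ σ ⊗[k] dR.obj X i →ₗ[AlongHom ℂ σ] AlongHom ℂ σ ⊗[ℚ] (B.comap σ).obj X i
  /-- The inverse comparison map `Hⁱ_B(X_σ) ⊗_ℚ ℂ →ₗ Hⁱ_dR(X) ⊗_{k,σ} ℂ`. -/
  isoInv (σ : k →+* ℂ) (X : SchemeOver k) (i : ℕ) :
    AlongHom ℂ σ ⊗[ℚ] (B.comap σ).obj X i →ₗ[AlongHom ℂ σ] AlongHom ℂ σ ⊗[k] dR.obj X i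
  /-- `isoInv ∘ iso = id` on smooth projective `X`. -/
  isoInv_iso : ∀ (σ : k →+* ℂ) ⦃n : ℕ⦄ ⦃X : SchemeOver k⦄, IsSmoothProjective n X →
    ∀ (i : ℕ) (x : AlongHom ℂ σ ⊗[k] dR.obj X i), isoInv σ X i (iso σ X i x) = x
  /-- `iso ∘ isoInv = id` on smooth projective `X`. -/
  iso_isoInv : ∀ (σ : k →+* ℂ) ⦃n : ℕ⦄ ⦃X : SchemeOver k⦄, IsSmoothProjective n X →
    ∀ (i : ℕ) (y : AlongHom ℂ σ ⊗[ℚ] (B.comap σ).obj X i), iso σ X i (isoInv σ X i y) = y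
  /-- Naturality: `iso_X ∘ (f*)_L = (f_σ*)_L ∘ iso_Y` for `f : X ⟶ Y` between smooth projective
  varieties (Grothendieck 1966; Deligne–Milne 1982, I §1). -/
  iso_pullback : ∀ (σ : k →+* ℂ) ⦃n : ℕ⦄ ⦃X : SchemeOver k⦄, IsSmoothProjective n X →
    ∀ ⦃m : ℕ⦄ ⦃Y : SchemeOver k⦄, IsSmoothProjective m Y → ∀ (f : X ⟶ Y) (i : ℕ)
      (x : AlongHom ℂ σ ⊗[k] dR.obj Y i),
      iso σ X i ((dR.pullback f i).baseChange (AlongHom ℂ σ) x) =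
        ((B.comap σ).pullback f i).baseChange (AlongHom ℂ σ) (iso σ Y i x)
  /-- The comparison preserves units: `iso (1 ⊗ 1) = 1 ⊗ 1`. -/
  iso_one : ∀ (σ : k →+* ℂ) ⦃n : ℕ⦄ ⦃X : SchemeOver k⦄, IsSmoothProjective n X →
    iso σ X 0 (1 ⊗ₜ dR.one X) = 1 ⊗ₜ (B.comap σ).one X
  /-- The comparison is multiplicative for the (`L`-bilinearly extended) cup products
  (Grothendieck 1966: an isomorphism of graded algebras). -/
  iso_cup : ∀ (σ : k →+* ℂ) ⦃n : ℕ⦄ ⦃X : SchemeOver k⦄, IsSmoothProjective n X →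
    ∀ ⦃i j m : ℕ⦄ (h : i + j = m) (x : AlongHom ℂ σ ⊗[k] dR.obj X i)
      (y : AlongHom ℂ σ ⊗[k] dR.obj X j),
      iso σ X m (dR.cupBaseChange (AlongHom ℂ σ) h x y) =
        (B.comap σ).cupBaseChange (AlongHom ℂ σ) h (iso σ X i x) (iso σ X j y)
  /-- Compatibility with traces on `H²ⁿ`, `n = dim X`, with the Tate twist:
  `tr_B (iso x) = (2πi)ⁿ · tr_dR x`, both traces being normalised by `tr (cl (pt)) = 1`
  (`WeilCohomology.trace_cycleClass`) and `tr_dR = (2πi)⁻ⁿ ∫_X` (Deligne 1982, §1;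
  Deligne–Milne 1982, I §1). This is the sign consistent with `iso_cycleClass`, see
  `trace_comap_cycleClass`. -/
  iso_trace : ∀ (σ : k →+* ℂ) ⦃n : ℕ⦄ ⦃X : SchemeOver k⦄, IsSmoothProjective n X →
    ∀ x : AlongHom ℂ σ ⊗[k] dR.obj X (2 * n),
      Module.Dual.baseChange (AlongHom ℂ σ) ((B.comap σ).trace X n) (iso σ X (2 * n) x) =
        twoPiI σ ^ n • Module.Dual.baseChange (AlongHom ℂ σ) (dR.trace X n) x
  /-- Compatibility with cycle classes of prime cycles of codimension `p`, with the Tate twist: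
  `iso (1 ⊗ cl_dR(Z)) = (2πi)ᵖ · (1 ⊗ cl_B(Z_σ))` (Deligne 1982, §1; Deligne–Milne 1982, I §1;
  outline §1(b)). -/
  iso_cycleClass : ∀ (σ : k →+* ℂ) ⦃n : ℕ⦄ ⦃X : SchemeOver k⦄, IsSmoothProjective n X →
    ∀ (p : ℕ) (z : X.left), Order.coheight z = p →
      iso σ X (2 * p) (1 ⊗ₜ dR.cycleClass X p z) =
        twoPiI σ ^ p • (1 ⊗ₜ (B.comap σ).cycleClass X p z)
  /-- Compatibility with the Hodge filtrations: `iso` carries `Fᵖ Hⁱ_dR(X) ⊗_{k,σ} ℂ` onto the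
  Hodge filtration `Fᵖ` of the Hodge structure on `Hⁱ_B(X_σ)` (Grothendieck 1966 with GAGA;
  Deligne, Hodge II, 2.2 and 3.2; stated after restricting scalars to `ℚ` and transporting along
  `alongHomTensorEquiv`). The Hodge structure on `Hⁱ_B(X_σ)` is `B.hodge hXσ i` for a proof
  `hXσ : IsSmoothProjective n X_σ` (which exists by the named fact
  `IsSmoothProjective.baseChangeHom`; `IsSmoothProjective` is a `Prop`, so the choice is
  irrelevant), quantified over as in `IsAbsoluteHodge`. -/
  iso_fil : ∀ (σ : k →+* ℂ) ⦃n : ℕ⦄ ⦃X : SchemeOver k⦄ (_hX : IsSmoothProjective n X)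
    (hXσ : IsSmoothProjective n ((baseChangeHom σ).obj X)) (i : ℕ) (p : ℤ),
      ((((dR.fil i p).baseChange (AlongHom ℂ σ)).map (iso σ X i)).restrictScalars ℚ).map
          (alongHomTensorEquiv σ ((B.comap σ).obj X i)).toLinearMap =
        ((B.hodge hXσ i).F p).restrictScalars ℚ

namespace PeriodRealization

variable {k : Type} [Field k] [CharZero k] (P : PeriodRealization k)

/-! ### API mirroring `WeilComparison` -/

/-- On a smooth projective `X`, the comparison map is an `L`-linear equivalence
`Hⁱ_dR(X) ⊗_{k,σ} ℂ ≃ₗ Hⁱ_B(X_σ) ⊗_ℚ ℂ` (Grothendieck 1966, Thm. 1'). [cite: Grothendieck1966, Thm. 1'] -/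
def isoEquiv (σ : k →+* ℂ) {n : ℕ} {X : SchemeOver k} (hX : IsSmoothProjective n X) (i : ℕ) :
    AlongHom ℂ σ ⊗[k] P.dR.obj X i ≃ₗ[AlongHom ℂ σ] AlongHom ℂ σ ⊗[ℚ] (P.B.comap σ).obj X i :=
  LinearEquiv.ofLinear (P.iso σ X i) (P.isoInv σ X i) (LinearMap.ext (P.iso_isoInv σ hX i))
    (LinearMap.ext (P.isoInv_iso σ hX i))

/-- `isoEquiv` is `iso` as a function (not `@[simp]`: the type mentions `B.comap`, which `simp` unfolds via
`PreWeilCohomology.comap_obj`). [folklore] -/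
lemma isoEquiv_apply (σ : k →+* ℂ) {n : ℕ} {X : SchemeOver k} (hX : IsSmoothProjective n X)
    (i : ℕ) (x : AlongHom ℂ σ ⊗[k] P.dR.obj X i) : P.isoEquiv σ hX i x = P.iso σ X i x := rfl

/-- The inverse of `isoEquiv` is `isoInv` as a function (not `@[simp]`: the type mentions `B.comap`, which `simp` unfolds via
`PreWeilCohomology.comap_obj`). [folklore] -/
lemma isoEquiv_symm_apply (σ : k →+* ℂ) {n : ℕ} {X : SchemeOver k}
    (hX : IsSmoothProjective n X) (i : ℕ) (y : AlongHom ℂ σ ⊗[ℚ] (P.B.comap σ).obj X i) :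
    (P.isoEquiv σ hX i).symm y = P.isoInv σ X i y := rfl

/-- On smooth projective `X` the comparison map is bijective (Grothendieck 1966, Thm. 1'). [cite: Grothendieck1966, Thm. 1'] -/
lemma bijective_iso (σ : k →+* ℂ) {n : ℕ} {X : SchemeOver k} (hX : IsSmoothProjective n X)
    (i : ℕ) : Function.Bijective (P.iso σ X i) :=
  (P.isoEquiv σ hX i).bijective

/-- Consistency of the two Tate twists: for a closed point `z` of a smooth projective `X` of
dimension `n`, `iso_trace` and `iso_cycleClass` applied to `cl_dR(z)` give
`(2πi)ⁿ · tr_B(cl_B(z_σ)) = (2πi)ⁿ · tr_dR(cl_dR(z)) = (2πi)ⁿ · deg z`, whence the Betti trace of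
the class of `z_σ = ∑ (points over z)` is `deg z = [κ(z) : k]`, as it must be
(`WeilCohomology.trace_cycleClass` for `B.W` summed over `pointsOver σ X z`; Deligne 1982, §1;
Kleiman 1968, §1.2 (C)). [cite: Deligne1982, §1] -/
theorem trace_comap_cycleClass (σ : k →+* ℂ) {n : ℕ} {X : SchemeOver k}
    (hX : IsSmoothProjective n X) (z : X.left) (hz : Order.coheight z = n) :
    ((P.B.comap σ).trace X n ((P.B.comap σ).cycleClass X n z) : ℚ) = X.hom.residueDegree z := by
  have h := P.iso_trace σ hX (1 ⊗ₜ P.dR.cycleClass X n z)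
  rw [P.iso_cycleClass σ hX n z hz, map_smul, Module.Dual.baseChange_apply_tmul,
    Module.Dual.baseChange_apply_tmul, P.dR.trace_cycleClass hX z hz, smul_eq_mul,
    smul_eq_mul] at h
  have h' := mul_left_cancel₀ (pow_ne_zero n (isUnit_twoPiI σ).ne_zero) h
  rw [Algebra.smul_def, Algebra.smul_def, mul_one, mul_one, map_natCast,
    ← map_natCast (algebraMap ℚ (AlongHom ℂ σ))] at h'
  exact (algebraMap ℚ (AlongHom ℂ σ)).injective h'

/-! ### Periods -/

section Periods

variable (σ : k →+* ℂ) (X : SchemeOver k)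

/-- The **periods** of `Hⁱ(X)` along `σ`, as complex numbers: the values `φ_ℂ (iso (1 ⊗ ω))`,
`ω ∈ Hⁱ_dR(X)`, `φ ∈ Hⁱ_B(X_σ)^∨`, i.e. the integrals `∫_γ ω` (G17 `periodSet` of `P.iso σ X i`
transported along `AlongHom.equiv σ`; Huber–Müller-Stach 2017, Def. 11.1.1; Deligne–Milne 1982,
I §1). [cite: HuberMullerStach2017, Def. 11.1.1] -/
def periodSetOf (i : ℕ) : Set ℂ :=
  AlongHom.equiv σ '' periodSet (P.iso σ X i)

/-- The **period field** of `X` along `σ`: the subfield of `ℂ` generated by the periods of all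
`Hⁱ(X)` (Huber–Müller-Stach 2017, §11.2, §13.1; the subject of Grothendieck's period
conjecture, Deligne–Milne 1982, I Rem. 1.13). For instance `2πi ∈ periodFieldOf σ ℙ¹`
(`twoPiI_mem_periodFieldOf`). [cite: HuberMullerStach2017, §11.2  §13.1] -/
def periodFieldOf : Subfield ℂ :=
  (Subfield.closure (⋃ i : ℕ, periodSet (P.iso σ X i))).map
    (AlongHom.equiv σ : AlongHom ℂ σ →+* ℂ)

variable {ι₁ ι₂ : Type*} [Fintype ι₁] [Fintype ι₂] [DecidableEq ι₁]

/-- The **period matrix** of `Hⁱ(X)` along `σ` in a `k`-basis `b₁` of `Hⁱ_dR(X)` and a `ℚ`-basis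
`b₂` of `Hⁱ_B(X_σ)`, with complex entries (G17 `periodMatrix`; Huber–Müller-Stach 2017,
§11.2). [cite: HuberMullerStach2017, §11.2] -/
def periodMatrixOf (i : ℕ) (b₁ : Module.Basis ι₁ k (P.dR.obj X i))
    (b₂ : Module.Basis ι₂ ℚ ((P.B.comap σ).obj X i)) : Matrix ι₂ ι₁ ℂ :=
  (periodMatrix (P.iso σ X i) b₁ b₂).map (AlongHom.equiv σ)

variable {σ X}

/-- Membership in `periodSetOf`, unfolded. [folklore] -/
lemma mem_periodSetOf_iff {i : ℕ} {x : ℂ} :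
    x ∈ P.periodSetOf σ X i ↔ ∃ (v : P.dR.obj X i) (φ : Module.Dual ℚ ((P.B.comap σ).obj X i)),
      x = AlongHom.equiv σ
        (Module.Dual.baseChange (AlongHom ℂ σ) φ (P.iso σ X i (1 ⊗ₜ v))) := by
  constructor
  · rintro ⟨_, ⟨v, φ, rfl⟩, rfl⟩
    exact ⟨v, φ, rfl⟩
  · rintro ⟨v, φ, rfl⟩
    exact ⟨_, ⟨v, φ, rfl⟩, rfl⟩

/-- Membership in `periodFieldOf`, unfolded to G17's vocabulary: `x ∈ ℂ` is in the period field
of `X` along `σ` iff, read in `L = AlongHom ℂ σ`, it lies in the subfield generated by the G17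
period sets `periodSet (P.iso σ X i)` of all degrees (the formula of G17
`WeilComparison.periodField`; Huber–Müller-Stach 2017, §11.2). [cite: HuberMullerStach2017, §11.2] -/
lemma mem_periodFieldOf_iff {x : ℂ} :
    x ∈ P.periodFieldOf σ X ↔
      (AlongHom.equiv σ).symm x ∈ Subfield.closure (⋃ i : ℕ, periodSet (P.iso σ X i)) := by
  constructor
  · rintro ⟨y, hy, rfl⟩
    simpa using hy
  · intro hx
    exact ⟨_, hx, (AlongHom.equiv σ).apply_symm_apply x⟩

/-- Periods read in `L = AlongHom ℂ σ`: `y ∈ periodSet (P.iso σ X i)` gives the complex period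
`AlongHom.equiv σ y ∈ P.periodFieldOf σ X`. [folklore] -/
lemma equiv_mem_periodFieldOf {i : ℕ} {y : AlongHom ℂ σ} (hy : y ∈ periodSet (P.iso σ X i)) :
    AlongHom.equiv σ y ∈ P.periodFieldOf σ X :=
  ⟨y, Subfield.subset_closure (Set.mem_iUnion.mpr ⟨i, hy⟩), rfl⟩

variable (σ X) in
/-- Periods of each degree lie in the period field of `X`. [folklore] -/
lemma periodSetOf_subset_periodFieldOf (i : ℕ) :
    P.periodSetOf σ X i ⊆ P.periodFieldOf σ X := by
  rintro _ ⟨x, hx, rfl⟩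
  exact P.equiv_mem_periodFieldOf hx

variable (σ X) in
/-- The entries of a period matrix are periods. [folklore] -/
lemma periodMatrixOf_mem_periodSetOf (i : ℕ) (b₁ : Module.Basis ι₁ k (P.dR.obj X i))
    (b₂ : Module.Basis ι₂ ℚ ((P.B.comap σ).obj X i)) (a : ι₂) (b : ι₁) :
    P.periodMatrixOf σ X i b₁ b₂ a b ∈ P.periodSetOf σ X i :=
  ⟨_, periodMatrix_mem_periodSet _ b₁ b₂ a b, rfl⟩

/-- `2πi` is a period of the projective line: it lies in the period field of `ℙ¹_k` along every
`σ` (from `iso_trace` on `H²(ℙ¹)`, `tr_B ∘ iso = (2πi) tr_dR` with `tr_dR` surjective; equally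
from `iso_cycleClass` for a `k`-point; Deligne 1982, §1; Huber–Müller-Stach 2017, §14.1). Takes the
named fact `hP1 : isSmoothProjective_projectiveSpace k 1` (`ℙ¹_k` is smooth projective of
dimension `1`). [cite: Deligne1982, §1] -/
theorem twoPiI_mem_periodFieldOf (hP1 : isSmoothProjective_projectiveSpace k 1) (σ : k →+* ℂ) :
    2 * Real.pi * Complex.I ∈ P.periodFieldOf σ (projectiveSpace 1 k) := by
  have hX : IsSmoothProjective 1 (projectiveSpace 1 k) := hP1
  obtain ⟨v, hv⟩ := (P.dR.bijective_trace hX).2 1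
  have hmem : twoPiI σ ∈ periodSet (P.iso σ (projectiveSpace 1 k) (2 * 1)) := by
    refine ⟨v, (P.B.comap σ).trace _ 1, ?_⟩
    rw [P.iso_trace σ hX, Module.Dual.baseChange_apply_tmul]
    change _ = _ • (P.dR.trace (projectiveSpace 1 k) 1 v • _)
    rw [hv, one_smul, pow_one, smul_eq_mul, mul_one]
  exact P.equiv_mem_periodFieldOf hmem

end Periods

/-! ### Absolute Hodge classes -/

section AbsoluteHodge

variable {n : ℕ} {X : SchemeOver k}

/-- A de Rham class `α ∈ H²ᵖ_dR(X/k)` is a **Hodge class relative to `σ`** if its image under the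
comparison along `σ` is `(2πi)ᵖ` times (the image of) a rational Hodge class
`β ∈ H²ᵖ_B(X_σ, ℚ) ∩ Fᵖ` (Deligne 1982, §2, before Def. 2.10; Charles–Schnell 2011, Def. 11). [cite: Deligne1982, §2  before Def. 2.10] -/
def IsHodgeRelativeTo (σ : k →+* ℂ) (hXσ : IsSmoothProjective n ((baseChangeHom σ).obj X))
    (p : ℕ) (α : P.dR.obj X (2 * p)) : Prop :=
  ∃ β : (P.B.comap σ).obj X (2 * p), β ∈ (P.B.hodge hXσ (2 * p)).hodgeClasses p ∧
    P.iso σ X (2 * p) (1 ⊗ₜ α) = twoPiI σ ^ p • (1 ⊗ₜ β)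

variable (n X) in
/-- A de Rham class `α ∈ H²ᵖ_dR(X/k)` on a smooth projective `X` of dimension `n` is an
**absolute Hodge class** if it is a Hodge class relative to every embedding `σ : k →+* ℂ`
(Deligne 1982, Def. 2.10, in the de Rham formulation of Charles–Schnell 2011, Def. 11 — the
`ℓ`-adic components are omitted). Only meaningful under `IsSmoothProjective n X` (then every
`X_σ` is smooth projective of dimension `n`, `IsSmoothProjective.baseChangeHom`, and the
quantifier over `hXσ` is not vacuous); consumers pass `hX`, cf.
`IsAbsoluteHodge.isHodgeRelativeTo`. [cite: Deligne1982, Def. 2.10  in the de Rham formulation of] -/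
def IsAbsoluteHodge (p : ℕ) (α : P.dR.obj X (2 * p)) : Prop :=
  ∀ (σ : k →+* ℂ) (hXσ : IsSmoothProjective n ((baseChangeHom σ).obj X)),
    P.IsHodgeRelativeTo σ hXσ p α

/-- `0` is a Hodge class relative to `σ` (`β = 0`). [folklore] -/
lemma IsHodgeRelativeTo.zero (σ : k →+* ℂ)
    (hXσ : IsSmoothProjective n ((baseChangeHom σ).obj X)) (p : ℕ) :
    P.IsHodgeRelativeTo σ hXσ p 0 :=
  ⟨0, zero_mem _, by rw [TensorProduct.tmul_zero, map_zero, TensorProduct.tmul_zero, smul_zero]⟩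

/-- Hodge classes relative to `σ` are stable under addition. [folklore] -/
lemma IsHodgeRelativeTo.add {σ : k →+* ℂ}
    {hXσ : IsSmoothProjective n ((baseChangeHom σ).obj X)} {p : ℕ} {α α' : P.dR.obj X (2 * p)}
    (h : P.IsHodgeRelativeTo σ hXσ p α) (h' : P.IsHodgeRelativeTo σ hXσ p α') :
    P.IsHodgeRelativeTo σ hXσ p (α + α') := by
  obtain ⟨β, hβ, e⟩ := h
  obtain ⟨β', hβ', e'⟩ := h'
  exact ⟨β + β', add_mem hβ hβ', by rw [TensorProduct.tmul_add, map_add, e, e',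
    TensorProduct.tmul_add, smul_add]⟩

/-- Hodge classes relative to `σ` are stable under negation. [folklore] -/
lemma IsHodgeRelativeTo.neg {σ : k →+* ℂ}
    {hXσ : IsSmoothProjective n ((baseChangeHom σ).obj X)} {p : ℕ} {α : P.dR.obj X (2 * p)}
    (h : P.IsHodgeRelativeTo σ hXσ p α) : P.IsHodgeRelativeTo σ hXσ p (-α) := by
  obtain ⟨β, hβ, e⟩ := h
  exact ⟨-β, neg_mem hβ, by rw [TensorProduct.tmul_neg, map_neg, e, TensorProduct.tmul_neg,
    smul_neg]⟩

variable (n X) in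
/-- The additive group of **absolute Hodge classes** in `H²ᵖ_dR(X/k)` (Deligne 1982, Def. 2.10;
Charles–Schnell 2011, Def. 11), as an `AddSubgroup` (mathematically a `ℚ`-subspace, not a
`k`-subspace; `H²ᵖ_dR(X)` carries no `Module ℚ` instance here). Only meaningful
under `IsSmoothProjective n X` (otherwise it may be vacuously `⊤`); consumers pass `hX`. [cite: Deligne1982, Def. 2.10] -/
def absoluteHodgeClasses (p : ℕ) : AddSubgroup (P.dR.obj X (2 * p)) where
  carrier := {α | P.IsAbsoluteHodge n X p α}
  zero_mem' σ hXσ := IsHodgeRelativeTo.zero P σ hXσ p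
  add_mem' h h' σ hXσ := (h σ hXσ).add P (h' σ hXσ)
  neg_mem' h σ hXσ := (h σ hXσ).neg P

/-- Membership in `absoluteHodgeClasses` is `IsAbsoluteHodge`. [folklore] -/
@[simp]
lemma mem_absoluteHodgeClasses_iff {p : ℕ} {α : P.dR.obj X (2 * p)} :
    α ∈ P.absoluteHodgeClasses n X p ↔ P.IsAbsoluteHodge n X p α :=
  Iff.rfl

/-- **Cycle classes are absolute Hodge** (Deligne 1982, Ex. 2.1(a); Charles–Schnell 2011,
Ex. 12): for a prime cycle `Z = closure {z}` of codimension `p` on a smooth projective `X`,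
`iso_σ (1 ⊗ cl_dR(Z)) = (2πi)ᵖ (1 ⊗ cl_B(Z_σ))` (`iso_cycleClass`) and `cl_B(Z_σ)`, the sum of the
classes of the components of `Z_σ`, is a rational Hodge class
(`B.cycleClass_mem_hodgeClasses`). [cite: Deligne1982, Ex. 2.1(a] -/
theorem cycleClass_isAbsoluteHodge (hX : IsSmoothProjective n X) (p : ℕ) (z : X.left)
    (hz : Order.coheight z = p) : P.IsAbsoluteHodge n X p (P.dR.cycleClass X p z) := by
  intro σ hXσ
  refine ⟨(P.B.comap σ).cycleClass X p z, ?_, P.iso_cycleClass σ hX p z hz⟩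
  change ∑ᶠ z' ∈ pointsOver σ X z, P.B.W.cycleClass ((baseChangeHom σ).obj X) p z' ∈ _
  refine finsum_mem_induction (· ∈ (P.B.hodge hXσ (2 * p)).hodgeClasses p) (zero_mem _)
    (fun _ _ hx hy ↦ add_mem hx hy) fun z' hz' ↦ ?_
  exact P.B.cycleClass_mem_hodgeClasses hXσ p z' (hz'.2.trans hz)

/-- Algebraic classes (the `ℤ`-span of cycle classes) are absolute Hodge (from
`cycleClass_isAbsoluteHodge`; Deligne 1982, Ex. 2.1(a)). [cite: Deligne1982, Ex. 2.1(a] -/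
theorem algebraicLattice_le_absoluteHodgeClasses (hX : IsSmoothProjective n X) (p : ℕ) :
    P.dR.algebraicLattice X p ≤ P.absoluteHodgeClasses n X p := by
  refine (AddSubgroup.closure_le _).mpr ?_
  rintro _ ⟨⟨z, hz⟩, rfl⟩
  exact P.cycleClass_isAbsoluteHodge hX p z hz

/-- The cup product of absolute Hodge classes is absolute Hodge (Deligne 1982, §2, after
Def. 2.10): `iso` is multiplicative (`iso_cup`, under `hX`) and
`(2πi)ᵖ (2πi)^q = (2πi)^{p+q}`, so it remains to know that rational Hodge classes on `X_σ` are
stable under cup product. In Deligne's setting this holds because cup product is a morphism of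
Hodge structures (`Fᵖ ∪ F^q ⊆ F^{p+q}`); the G17 hypothesis structure `BettiHodgeData` does not
record this compatibility of `W.cup` with `hodge` (G17 debt), so it is taken here as the explicit
hypothesis `hcup` (for every proof `hXσ : IsSmoothProjective n X_σ`, as in `IsAbsoluteHodge`). [cite: Deligne1982, §2  after Def. 2.10] -/
theorem IsAbsoluteHodge.cup (hX : IsSmoothProjective n X)
    (hcup : ∀ (σ : k →+* ℂ) (hXσ : IsSmoothProjective n ((baseChangeHom σ).obj X))
      ⦃p q r : ℕ⦄ (h : 2 * p + 2 * q = 2 * r)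
      ⦃a : (P.B.comap σ).obj X (2 * p)⦄ ⦃b : (P.B.comap σ).obj X (2 * q)⦄,
      a ∈ (P.B.hodge hXσ (2 * p)).hodgeClasses p →
      b ∈ (P.B.hodge hXσ (2 * q)).hodgeClasses q →
      (P.B.comap σ).cup h a b ∈ (P.B.hodge hXσ (2 * r)).hodgeClasses r)
    {p q r : ℕ} (h : p + q = r) {α : P.dR.obj X (2 * p)} {β : P.dR.obj X (2 * q)}
    (hα : P.IsAbsoluteHodge n X p α) (hβ : P.IsAbsoluteHodge n X q β) :
    P.IsAbsoluteHodge n X r (P.dR.cup (show 2 * p + 2 * q = 2 * r by omega) α β) := by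
  intro σ hXσ
  obtain ⟨a, ha, ea⟩ := hα σ hXσ
  obtain ⟨b, hb, eb⟩ := hβ σ hXσ
  have h2 : 2 * p + 2 * q = 2 * r := by omega
  refine ⟨(P.B.comap σ).cup h2 a b, hcup σ hXσ h2 ha hb, ?_⟩
  have e1 : (1 : AlongHom ℂ σ) ⊗ₜ[k] P.dR.cup h2 α β =
      P.dR.cupBaseChange (AlongHom ℂ σ) h2 (1 ⊗ₜ α) (1 ⊗ₜ β) := by
    rw [PreWeilCohomology.cupBaseChange_tmul, one_mul]
  rw [e1, P.iso_cup σ hX h2, ea, eb, LinearMap.map_smul₂, map_smul,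
    PreWeilCohomology.cupBaseChange_tmul, one_mul, smul_smul, ← pow_add, h]

/-- Absolute Hodge classes are Hodge classes relative to the base change along the structure
embedding: an absolute Hodge class on `X` smooth projective of dimension `n` is Hodge relative to
every `σ` (by definition, with `hXσ := hbc σ hX` supplied by the named fact
`hbc : IsSmoothProjective.baseChangeHom`). [folklore] -/
lemma IsAbsoluteHodge.isHodgeRelativeTo
    (hbc : IsSmoothProjective.baseChangeHom (k := k) (L := ℂ)) {p : ℕ} {α : P.dR.obj X (2 * p)}
    (hα : P.IsAbsoluteHodge n X p α) (hX : IsSmoothProjective n X) (σ : k →+* ℂ) :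
    P.IsHodgeRelativeTo σ (hbc σ hX) p α :=
  hα σ (hbc σ hX)

end AbsoluteHodge

end PeriodRealization

end Literature.AlgebraicGeometry.Motives

end
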